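import Literature.Geometry.Riemannian.MeanConvexHandleShear
import Literature.Geometry.Riemannian.MeanConvexFrameSum
import Literature.Geometry.Riemannian.MeanConvexSurroundingDefiningFunction

/-!
# The height function over the mean-convex boundary (Fermi data, part 2)

Topic `Geometry/Riemannian` (fact seat
`provefact-Literature.Geometry.Riemannian.LawsonMichelsohn1984_surrounding`).  Everything here
is **proved**; no definitions.

The second Fermi datum of the junction in Lawson–Michelsohn's handle theorem (Thm. 3.1) is a
height function `t` over `Σ = {G = 0}`: we take `t = u G` with `u > 0` smooth and `u = 1/‖∇G‖`
on a neighbourhood of a given compact set `K` of regular points of `G`.  Then `{t = 0} = Σ`,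
`sign t = sign G`, `∇t = ∇G/‖∇G‖` is a unit normal on `Σ`, `‖∇t‖² - 1 = O(G) = O(t)` on `K`, the
frame sums of `D²t` over tangent hyperplanes of `Σ` are those of `G` divided by `‖∇G‖`
(positive by the mean-convexity hypothesis), and this positivity persists, quantitatively, on
`{z ∈ K : |t z| ≤ wd}` (the "help term" of the far zone of the junction).

* `exists_pos_forall_abs_le_subset` — compactness: `{z ∈ K : |φ z| ≤ wd} ⊆ O` for small `wd` when
  `K ∩ {φ = 0} ⊆ O`;
* `exists_fermiHeight` — the height function and its estimates.

## References

* H. B. Lawson, Jr., M.-L. Michelsohn, *Embedding and surrounding with positive mean curvature*,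
  Invent. Math. 77 (1984), §3. [LawsonMichelsohn1984]
-/

noncomputable section

open Set Function Filter Metric Module
open scoped Topology Manifold ContDiff RealInnerProductSpace

namespace Literature.Geometry.Riemannian

open Literature.Topology.FourManifolds

/-! ### Compactness helpers -/

section Compactness

variable {X : Type*} [TopologicalSpace X]

/-- A function continuous on a compact set and positive there is bounded below by a positive
constant. [folklore] -/
theorem exists_pos_forall_le_of_continuousOn {ψ : X → ℝ} {K : Set X} (hK : IsCompact K)
    (hψ : ContinuousOn ψ K) (hpos : ∀ x ∈ K, 0 < ψ x) : ∃ κ, 0 < κ ∧ ∀ x ∈ K, κ ≤ ψ x := by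
  rcases K.eq_empty_or_nonempty with h | h
  · exact ⟨1, one_pos, fun x hx => by rw [h] at hx; exact hx.elim⟩
  · obtain ⟨x₀, hx₀, hmin⟩ := hK.exists_isMinOn h hψ
    exact ⟨ψ x₀, hpos x₀ hx₀, fun x hx => hmin hx⟩

/-- **Thin slabs of a compact set enter any neighbourhood of the zero slice**: if `φ` is
continuous on the compact `K` and `K ∩ {φ = 0} ⊆ O`, `O` open, then `{z ∈ K : |φ z| ≤ wd} ⊆ O` for
some `wd > 0`. [folklore] -/
theorem exists_pos_forall_abs_le_subset {φ : X → ℝ} {K O : Set X} (hK : IsCompact K)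
    (hφ : ContinuousOn φ K) (hO : IsOpen O) (hKO : ∀ z ∈ K, φ z = 0 → z ∈ O) :
    ∃ wd, 0 < wd ∧ ∀ z ∈ K, |φ z| ≤ wd → z ∈ O := by
  have hc : IsCompact (K ∩ Oᶜ) := hK.inter_right hO.isClosed_compl
  have hpos : ∀ z ∈ K ∩ Oᶜ, 0 < |φ z| := fun z hz =>
    abs_pos.2 fun h => hz.2 (hKO z hz.1 h)
  obtain ⟨κ, hκ, hκle⟩ := exists_pos_forall_le_of_continuousOn hc
    ((continuous_abs.comp_continuousOn hφ).mono inter_subset_left) hpos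
  refine ⟨κ / 2, by positivity, fun z hz hzω => ?_⟩
  by_contra hzO
  have := hκle z ⟨hz, hzO⟩
  simp only [Function.comp] at this
  linarith

/-- A function continuous on a compact set is bounded in absolute value. [folklore] -/
theorem exists_forall_abs_le_of_continuousOn {ψ : X → ℝ} {K : Set X} (hK : IsCompact K)
    (hψ : ContinuousOn ψ K) : ∃ M, 0 ≤ M ∧ ∀ x ∈ K, |ψ x| ≤ M := by
  obtain ⟨M, hM⟩ := hK.exists_bound_of_continuousOn hψ
  exact ⟨max M 0, le_max_right _ _, fun x hx =>
    ((Real.norm_eq_abs _).symm.le.trans (hM x hx)).trans (le_max_left _ _)⟩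

/-- A vector-valued function continuous on a compact set is bounded in norm. [folklore] -/
theorem exists_forall_norm_le_of_continuousOn {F : Type*} [SeminormedAddCommGroup F] {ψ : X → F}
    {K : Set X} (hK : IsCompact K) (hψ : ContinuousOn ψ K) : ∃ M, 0 ≤ M ∧ ∀ x ∈ K, ‖ψ x‖ ≤ M := by
  obtain ⟨M, hM⟩ := hK.exists_bound_of_continuousOn hψ
  exact ⟨max M 0, le_max_right _ _, fun x hx => (hM x hx).trans (le_max_left _ _)⟩

end Compactness

/-! ### Orthonormal frames of a hyperplane -/

section Frame

variable {E : Type*} [NormedAddCommGroup E] [InnerProductSpace ℝ E] [FiniteDimensional ℝ E] {m : ℕ}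

/-- In an `(m + 1)`-dimensional inner product space, `g^⊥` (`g ≠ 0`) carries an orthonormal
`m`-frame. [folklore] -/
theorem exists_orthonormal_frame_orthogonal (hE : finrank ℝ E = m + 1) {g : E} (hg : g ≠ 0) :
    ∃ v : Fin m → E, Orthonormal ℝ v ∧ ∀ i, ⟪v i, g⟫ = 0 := by
  set K : Submodule ℝ E := (Submodule.span ℝ ({g} : Set E))ᗮ with hK
  have hKdim : finrank ℝ K = m := by
    have h1 : finrank ℝ (Submodule.span ℝ ({g} : Set E)) = 1 := finrank_span_singleton hg
    have h2 := Submodule.finrank_add_finrank_orthogonal (Submodule.span ℝ ({g} : Set E))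
    rw [h1, hE] at h2
    rw [hK]; omega
  set w := (stdOrthonormalBasis ℝ K).reindex (finCongr hKdim) with hw
  refine ⟨fun i => (w i : E), ?_, fun i => ?_⟩
  · have h := w.orthonormal
    exact (K.subtypeₗᵢ.orthonormal_comp_iff).2 h
  · have hmem : (w i : E) ∈ (Submodule.span ℝ ({g} : Set E))ᗮ := (w i).2
    exact Submodule.mem_orthogonal_singleton_iff_inner_left.1 hmem

end Frame

/-! ### The height function -/

section Height

variable {n : ℕ}

/-- If `V` is `C^n` on the open set `O`, `χ` is `C^n` and the support of `χ` lies in `O`, then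
`χ • V` is `C^n` (private copy of the tree's `OneFormChartCompactness` lemma). [folklore] -/
private theorem contDiff_smul_of_tsupport_subset_aux' {E F : Type*} [NormedAddCommGroup E]
    [NormedSpace ℝ E] [NormedAddCommGroup F] [NormedSpace ℝ F] {n' : WithTop ℕ∞} {χ : E → ℝ}
    {V : E → F} {O : Set E} (hO : IsOpen O) (hV : ContDiffOn ℝ n' V O) (hχ : ContDiff ℝ n' χ)
    (hsupp : tsupport χ ⊆ O) : ContDiff ℝ n' fun z => χ z • V z := by
  refine contDiff_iff_contDiffAt.2 fun z => ?_
  by_cases hz : z ∈ O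
  · exact hχ.contDiffAt.smul (hV.contDiffAt (hO.mem_nhds hz))
  · have hz' : z ∉ tsupport χ := fun h => hz (hsupp h)
    have hev : (fun z => χ z • V z) =ᶠ[𝓝 z] fun _ => 0 := by
      filter_upwards [(isClosed_tsupport χ).isOpen_compl.mem_nhds hz'] with y hy
      rw [image_eq_zero_of_notMem_tsupport hy, zero_smul]
    exact contDiffAt_const.congr_of_eventuallyEq hev

set_option maxHeartbeats 1600000 in
/-- **The height function over the mean-convex boundary.**  Let `G` be `C^∞` on `ℝⁿ`,
`n = m + 1`, strictly mean convex (in the frame-sum sense) at the regular points of `{G = 0}`,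
and `K` a compact set of regular points of `G`.  Then there are a `C^∞` function `u > 0` and
constants `C_t, M₁, M₂, H₀, wd > 0` such that `t = u G` satisfies: `u = 1/‖∇G‖` near `K`
(so `dt(z) = u z • dG(z)` and `‖∇t‖ = 1` at the zeros of `G` in `K`), `|‖∇t z‖² - 1| ≤ C_t |t z|`,
`‖dt(z)‖ ≤ M₁`, `‖D²t(z)‖ ≤ M₂`, `|G z| ≤ M₁ |t z|` on `K`, and the **help term** bound
`∑ⱼ D²t(z)(bⱼ, bⱼ) - D²t(z)(∇t, ∇t)/‖∇t‖² ≥ H₀` for `z ∈ K` with `|t z| ≤ wd` (where also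
`‖∇t z‖ ≥ 1/2`). [cite: LawsonMichelsohn1984, §3] -/
theorem exists_fermiHeight {m : ℕ} {G : EuclideanSpace ℝ (Fin (m + 1)) → ℝ} (hG : ContDiff ℝ ∞ G)
    (hmc : ∀ x, G x = 0 → fderiv ℝ G x ≠ 0 → ∀ v : Fin m → EuclideanSpace ℝ (Fin (m + 1)),
      Orthonormal ℝ v → (∀ i, fderiv ℝ G x (v i) = 0) →
      0 < ∑ i, iteratedFDeriv ℝ 2 G x ![v i, v i])
    {K : Set (EuclideanSpace ℝ (Fin (m + 1)))} (hK : IsCompact K) (hKreg : ∀ z ∈ K, fderiv ℝ G z ≠ 0) :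
    ∃ (u : EuclideanSpace ℝ (Fin (m + 1)) → ℝ) (C_t M₁ M₂ H₀ wd : ℝ),
      ContDiff ℝ ∞ u ∧ (∀ z, 0 < u z) ∧ 0 < C_t ∧ 0 < M₁ ∧ 0 < M₂ ∧ 0 < H₀ ∧ 0 < wd ∧
      (∀ z ∈ K, u z = ‖(InnerProductSpace.toDual ℝ _).symm (fderiv ℝ G z)‖⁻¹) ∧
      (∀ z ∈ K, fderiv ℝ (fun z => u z * G z) z =
        u z • fderiv ℝ G z + G z • fderiv ℝ u z) ∧
      (∀ z ∈ K, |‖(InnerProductSpace.toDual ℝ _).symm (fderiv ℝ (fun z => u z * G z) z)‖ ^ 2 - 1| ≤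
        C_t * |u z * G z|) ∧
      (∀ z ∈ K, ‖fderiv ℝ (fun z => u z * G z) z‖ ≤ M₁) ∧
      (∀ z ∈ K, ‖fderiv ℝ (fderiv ℝ (fun z => u z * G z)) z‖ ≤ M₂) ∧
      (∀ z ∈ K, |G z| ≤ M₁ * |u z * G z|) ∧
      (∀ z ∈ K, |u z * G z| ≤ wd →
        1 / 2 ≤ ‖(InnerProductSpace.toDual ℝ _).symm (fderiv ℝ (fun z => u z * G z) z)‖ ∧
        H₀ ≤ ∑ j, fderiv ℝ (fderiv ℝ (fun z => u z * G z)) z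
              (EuclideanSpace.basisFun (Fin (m + 1)) ℝ j) (EuclideanSpace.basisFun (Fin (m + 1)) ℝ j) -
            fderiv ℝ (fderiv ℝ (fun z => u z * G z)) z
                ((InnerProductSpace.toDual ℝ _).symm (fderiv ℝ (fun z => u z * G z) z))
                ((InnerProductSpace.toDual ℝ _).symm (fderiv ℝ (fun z => u z * G z) z)) /
              ‖(InnerProductSpace.toDual ℝ _).symm (fderiv ℝ (fun z => u z * G z) z)‖ ^ 2) := by
  classical
  -- ### the gradient of `G`
  set b := EuclideanSpace.basisFun (Fin (m + 1)) ℝ with hb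
  set grad : EuclideanSpace ℝ (Fin (m + 1)) → EuclideanSpace ℝ (Fin (m + 1)) := fun z =>
    ∑ i, fderiv ℝ G z (b i) • b i with hgrad
  have hgrad_eq : ∀ z, grad z = (InnerProductSpace.toDual ℝ _).symm (fderiv ℝ G z) :=
    fun z => sum_fderiv_apply_smul_eq_toDual_symm (fderiv ℝ G z)
  have hgradc : ContDiff ℝ ∞ grad := by
    refine ContDiff.sum fun i _ => ?_
    have h1 : ContDiff ℝ ∞ fun z => fderiv ℝ G z (b i) :=
      (hG.fderiv_right (m := ∞) (by simp)).clm_apply contDiff_const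
    exact h1.smul contDiff_const
  have hgrad_ne : ∀ z, fderiv ℝ G z ≠ 0 → grad z ≠ 0 := fun z hz h => by
    apply hz
    rw [hgrad_eq] at h
    exact (InnerProductSpace.toDual ℝ _).symm.injective (by rw [h, map_zero])
  have hgrad_inner : ∀ z w, ⟪grad z, w⟫ = fderiv ℝ G z w := fun z w => by
    rw [hgrad_eq, InnerProductSpace.toDual_symm_apply]
  -- the open set of regular points and a cut-off around `K`
  set Reg : Set (EuclideanSpace ℝ (Fin (m + 1))) := {z | fderiv ℝ G z ≠ 0} with hReg
  have hRegopen : IsOpen Reg := isOpen_ne_fun (hG.continuous_fderiv (by simp)) continuous_const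
  have hKReg : K ⊆ Reg := fun z hz => hKreg z hz
  obtain ⟨ρ, hρ, hρReg⟩ := hK.exists_cthickening_subset_open hRegopen hKReg
  have hint : K ⊆ interior (cthickening ρ K) :=
    (self_subset_thickening hρ _).trans (interior_maximal (thickening_subset_cthickening ρ _) isOpen_thickening)
  obtain ⟨χ, hχ1, hχ0, hχ01⟩ := exists_contMDiffMap_one_nhds_of_subset_interior
    𝓘(ℝ, EuclideanSpace ℝ (Fin (m + 1))) (n := (⊤ : ℕ∞)) hK.isClosed hint
  have hχc : ContDiff ℝ ∞ χ := contMDiff_iff_contDiff.1 χ.contMDiff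
  have hχsupp : tsupport χ ⊆ Reg :=
    (closure_minimal (fun z hz => by_contra fun h => (mem_support.1 hz) (hχ0 z h)) isClosed_cthickening).trans hρReg
  -- ### the multiplier `u = χ/‖∇G‖ + (1 - χ)`
  set u : EuclideanSpace ℝ (Fin (m + 1)) → ℝ := fun z => χ z • ‖grad z‖⁻¹ + (1 - χ z) with hu
  have hinvc : ContDiffOn ℝ ∞ (fun z => ‖grad z‖⁻¹) Reg := by
    refine ContDiffOn.inv (fun z hz => (hgradc.contDiffAt.norm ℝ (hgrad_ne z hz)).contDiffWithinAt) ?_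
    exact fun z hz => norm_ne_zero_iff.2 (hgrad_ne z hz)
  have huc : ContDiff ℝ ∞ u :=
    (contDiff_smul_of_tsupport_subset_aux' hRegopen hinvc hχc hχsupp).add (contDiff_const.sub hχc)
  have hupos : ∀ z, 0 < u z := by
    intro z
    rw [hu]; dsimp only
    rw [smul_eq_mul]
    have h01 := hχ01 z
    by_cases hz : χ z = 0
    · rw [hz]; norm_num
    · have hzR : z ∈ Reg := hχsupp (subset_tsupport _ hz)
      have hpos : 0 < ‖grad z‖⁻¹ := inv_pos.2 (norm_pos_iff.2 (hgrad_ne z hzR))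
      have hχpos : 0 < χ z := lt_of_le_of_ne h01.1 (Ne.symm hz)
      nlinarith [h01.2]
  have huK : ∀ z ∈ K, u z = ‖grad z‖⁻¹ := fun z hz => by
    have : χ z = 1 := (hχ1.filter_mono (nhds_le_nhdsSet hz)).self_of_nhds
    rw [hu]; dsimp only; rw [this, one_smul, sub_self, add_zero]
  -- `u = 1/‖∇G‖` on a neighbourhood of `K` (where `χ = 1`)
  have huK_ev : ∀ z ∈ K, ∀ᶠ y in 𝓝 z, u y = ‖grad y‖⁻¹ := fun z hz => by
    filter_upwards [hχ1.filter_mono (nhds_le_nhdsSet hz)] with y hy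
    rw [hu]; dsimp only; rw [hy, one_smul, sub_self, add_zero]
  -- ### the height function
  set t : EuclideanSpace ℝ (Fin (m + 1)) → ℝ := fun z => u z * G z with ht
  have htc : ContDiff ℝ ∞ t := huc.mul hG
  have hGd : Differentiable ℝ G := hG.differentiable (by simp)
  have hud : Differentiable ℝ u := huc.differentiable (by simp)
  have hdt : ∀ z, fderiv ℝ t z = u z • fderiv ℝ G z + G z • fderiv ℝ u z := fun z => by
    rw [ht, fderiv_fun_mul (hud z) (hGd z)]
  -- gradients
  set gu : EuclideanSpace ℝ (Fin (m + 1)) → EuclideanSpace ℝ (Fin (m + 1)) := fun z =>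
    (InnerProductSpace.toDual ℝ _).symm (fderiv ℝ u z) with hgu
  set gt : EuclideanSpace ℝ (Fin (m + 1)) → EuclideanSpace ℝ (Fin (m + 1)) := fun z =>
    (InnerProductSpace.toDual ℝ _).symm (fderiv ℝ t z) with hgt
  have hgt_eq : ∀ z, gt z = u z • grad z + G z • gu z := fun z => by
    rw [hgt]; dsimp only; rw [hdt z, map_add, map_smul, map_smul, ← hgrad_eq]
  -- ### bounds on `K`
  have hgradcont : ContinuousOn grad K := hgradc.continuous.continuousOn
  have hgucont : Continuous gu := (InnerProductSpace.toDual ℝ _).symm.continuous.comp (huc.continuous_fderiv (by simp))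
  obtain ⟨MG, hMG0, hMG⟩ := exists_forall_norm_le_of_continuousOn hK hgradcont
  obtain ⟨Mu, hMu0, hMu⟩ := exists_forall_norm_le_of_continuousOn hK hgucont.continuousOn
  obtain ⟨MG0, hMG00, hMG0'⟩ := exists_forall_abs_le_of_continuousOn hK hG.continuous.continuousOn
  -- `‖∇G‖ ≥ g₀ > 0` on `K`
  obtain ⟨g₀, hg₀, hg₀le⟩ := exists_pos_forall_le_of_continuousOn hK (continuous_norm.comp_continuousOn hgradcont)
    fun z hz => norm_pos_iff.2 (hgrad_ne z (hKreg z hz))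
  -- `‖∇t‖² - 1 = G (2 u ⟨∇G, ∇u⟩ + G ‖∇u‖²)` on `K`
  have hnorm_gt : ∀ z ∈ K, ‖gt z‖ ^ 2 - 1 = G z * (2 * u z * ⟪grad z, gu z⟫ + G z * ‖gu z‖ ^ 2) := by
    intro z hz
    have hu1 : u z * ‖grad z‖ = 1 := by
      rw [huK z hz, inv_mul_cancel₀ (norm_ne_zero_iff.2 (hgrad_ne z (hKreg z hz)))]
    rw [hgt_eq z, ← real_inner_self_eq_norm_sq, inner_add_left, inner_add_right, inner_add_right,
      real_inner_smul_left, real_inner_smul_left, real_inner_smul_right, real_inner_smul_right,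
      real_inner_smul_left, real_inner_smul_right, real_inner_smul_right, real_inner_smul_left,
      real_inner_self_eq_norm_sq, real_inner_self_eq_norm_sq, real_inner_comm (gu z) (grad z)]
    nlinarith [hu1]
  set C_t : ℝ := MG * (2 * Mu + MG0 * Mu ^ 2) + 1 with hC_t
  have hC_tpos : 0 < C_t := by rw [hC_t]; positivity
  have hGt : ∀ z ∈ K, |G z| ≤ MG * |t z| := fun z hz => by
    have ht' : t z = u z * G z := rfl
    rw [ht', huK z hz, abs_mul, abs_inv, abs_norm]
    have hgp : 0 < ‖grad z‖ := norm_pos_iff.2 (hgrad_ne z (hKreg z hz))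
    rw [← mul_assoc, show MG * ‖grad z‖⁻¹ = MG / ‖grad z‖ from rfl]
    have : 1 ≤ MG / ‖grad z‖ := by rw [le_div_iff₀ hgp, one_mul]; exact hMG z hz
    nlinarith [abs_nonneg (G z)]
  have hdefect : ∀ z ∈ K, |‖gt z‖ ^ 2 - 1| ≤ C_t * |t z| := by
    intro z hz
    rw [hnorm_gt z hz, abs_mul]
    have hu_le : u z * ‖grad z‖ = 1 := by
      rw [huK z hz, inv_mul_cancel₀ (norm_ne_zero_iff.2 (hgrad_ne z (hKreg z hz)))]
    have h1 : |2 * u z * ⟪grad z, gu z⟫ + G z * ‖gu z‖ ^ 2| ≤ 2 * Mu + MG0 * Mu ^ 2 := by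
      refine (abs_add_le _ _).trans (add_le_add ?_ ?_)
      · rw [abs_mul, abs_mul, abs_two]
        have := abs_real_inner_le_norm (grad z) (gu z)
        have hu0 : 0 ≤ u z := (hupos z).le
        rw [abs_of_nonneg hu0]
        calc 2 * u z * |⟪grad z, gu z⟫| ≤ 2 * u z * (‖grad z‖ * ‖gu z‖) := by gcongr
          _ = 2 * (u z * ‖grad z‖) * ‖gu z‖ := by ring
          _ = 2 * ‖gu z‖ := by rw [hu_le, mul_one]
          _ ≤ 2 * Mu := by linarith [hMu z hz]
      · rw [abs_mul, abs_of_nonneg (sq_nonneg ‖gu z‖)]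
        have := hMu z hz
        have h2 : ‖gu z‖ ^ 2 ≤ Mu ^ 2 := pow_le_pow_left₀ (norm_nonneg _) this 2
        exact mul_le_mul (hMG0' z hz) h2 (sq_nonneg _) hMG00
    calc |G z| * |2 * u z * ⟪grad z, gu z⟫ + G z * ‖gu z‖ ^ 2|
        ≤ MG * |t z| * (2 * Mu + MG0 * Mu ^ 2) :=
          mul_le_mul (hGt z hz) h1 (abs_nonneg _) (by positivity)
      _ ≤ C_t * |t z| := by rw [hC_t]; nlinarith [abs_nonneg (t z), hMG0, hMu0, hMG00]
  -- bounds on `dt` and `D²t` on `K`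
  obtain ⟨M₁', hM₁'0, hM₁'⟩ := exists_forall_norm_le_of_continuousOn hK
    (htc.continuous_fderiv (by simp)).continuousOn
  obtain ⟨M₂', hM₂'0, hM₂'⟩ := exists_forall_norm_le_of_continuousOn hK
    ((htc.fderiv_right (m := ∞) (by simp)).continuous_fderiv (by simp)).continuousOn
  set M₁ : ℝ := max M₁' MG + 1 with hM₁
  set M₂ : ℝ := M₂' + 1 with hM₂
  -- ### the help term at the zeros of `G` in `K`
  set Hfun : EuclideanSpace ℝ (Fin (m + 1)) → ℝ := fun z =>
    ∑ j, fderiv ℝ (fderiv ℝ t) z (b j) (b j) - fderiv ℝ (fderiv ℝ t) z (gt z) (gt z) / ‖gt z‖ ^ 2 with hHfun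
  -- `Hfun` is continuous where `dt ≠ 0`
  have hD2c : Continuous (fderiv ℝ (fderiv ℝ t)) :=
    (htc.fderiv_right (m := ∞) (by simp)).continuous_fderiv (by simp)
  have hgtc : Continuous gt := (InnerProductSpace.toDual ℝ _).symm.continuous.comp (htc.continuous_fderiv (by simp))
  have hHcont : ContinuousOn Hfun {z | gt z ≠ 0} := by
    refine ContinuousOn.sub (Continuous.continuousOn (continuous_finsetSum _ fun j _ => ?_)) ?_
    · exact ((hD2c.clm_apply continuous_const).clm_apply continuous_const)
    · refine ContinuousOn.div ?_ ?_ fun z hz => pow_ne_zero 2 (norm_ne_zero_iff.2 hz)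
      · exact ((hD2c.clm_apply hgtc).clm_apply hgtc).continuousOn
      · exact ((continuous_norm.comp hgtc).pow 2).continuousOn
  -- at a zero `s ∈ K`: `gt s = grad s/‖grad s‖`, and `Hfun s > 0`
  have hzero : ∀ s ∈ K, G s = 0 → gt s = (‖grad s‖)⁻¹ • grad s ∧ ‖gt s‖ = 1 ∧ 0 < Hfun s := by
    intro s hs hGs
    have hgs : 0 < ‖grad s‖ := norm_pos_iff.2 (hgrad_ne s (hKreg s hs))
    have hgt_s : gt s = (‖grad s‖)⁻¹ • grad s := by rw [hgt_eq s, hGs, zero_smul, add_zero, huK s hs]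
    have hnorm : ‖gt s‖ = 1 := by
      rw [hgt_s, norm_smul, norm_inv, norm_norm, inv_mul_cancel₀ hgs.ne']
    refine ⟨hgt_s, hnorm, ?_⟩
    -- frame sum over an orthonormal frame of `ker dt(s) = ker dG(s)`
    have hE : finrank ℝ (EuclideanSpace ℝ (Fin (m + 1))) = m + 1 := finrank_euclideanSpace_fin
    have hdt_ne : fderiv ℝ t s ≠ 0 := by
      intro h0
      have : gt s = 0 := by rw [hgt]; dsimp only; rw [h0, map_zero]
      rw [this, norm_zero] at hnorm; exact zero_ne_one hnorm
    have hgt_ne : gt s ≠ 0 := by rw [← norm_ne_zero_iff, hnorm]; exact one_ne_zero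
    obtain ⟨v, hv, hvg⟩ := exists_orthonormal_frame_orthogonal hE hgt_ne
    have hvt : ∀ i, fderiv ℝ t s (v i) = 0 := fun i => by
      rw [← InnerProductSpace.toDual_symm_apply, real_inner_comm]; exact hvg i
    have hvG : ∀ i, fderiv ℝ G s (v i) = 0 := fun i => by
      have h := hvt i
      rw [hdt s, hGs] at h
      simp only [zero_smul, add_zero, FunLike.coe_smul, Pi.smul_apply, smul_eq_mul] at h
      exact (mul_eq_zero.1 h).resolve_left (hupos s).ne'
    have hkey := sum_iteratedFDeriv_two_ker_eq hE hdt_ne b hv hvt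
    -- `∑ᵢ D²t(vᵢ, vᵢ) = u s ∑ᵢ D²G(vᵢ, vᵢ) > 0`
    have hpos : 0 < ∑ i, iteratedFDeriv ℝ 2 t s ![v i, v i] := by
      have h2 : (2 : ℕ∞ω) ≤ ∞ := WithTop.coe_le_coe.mpr le_top
      have h := sum_iteratedFDeriv_two_mul_of_eq_zero (f := G) (g := u)
        (hG.contDiffAt.of_le h2) (huc.contDiffAt.of_le h2) hGs hvG
      have e : (fun y => u y * G y) = t := rfl
      rw [e] at h
      rw [h]
      exact mul_pos (hupos s) (hmc s hGs (hKreg s hs) v hv hvG)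
    rw [hkey] at hpos
    have e2 : ∀ a c, iteratedFDeriv ℝ 2 t s ![a, c] = fderiv ℝ (fderiv ℝ t) s a c := fun a c => by
      rw [iteratedFDeriv_two_vecCons]
    simp only [e2] at hpos
    rw [hHfun]; dsimp only
    convert hpos using 2
  -- ### the uniform neighbourhood
  have hK₀c : IsCompact (K ∩ {z | G z = 0}) := hK.inter_right (isClosed_eq hG.continuous continuous_const)
  have hK₀sub : K ∩ {z | G z = 0} ⊆ {z | gt z ≠ 0} := fun z hz => by
    rw [mem_setOf_eq, ← norm_ne_zero_iff, (hzero z hz.1 hz.2).2.1]; exact one_ne_zero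
  obtain ⟨κ, hκ, hκle⟩ := exists_pos_forall_le_of_continuousOn hK₀c (hHcont.mono hK₀sub)
    fun z hz => (hzero z hz.1 hz.2).2.2
  set H₀ : ℝ := κ / 2 with hH₀
  set Ugood : Set (EuclideanSpace ℝ (Fin (m + 1))) :=
    {z | gt z ≠ 0} ∩ Hfun ⁻¹' Ioi H₀ ∩ (fun z => ‖gt z‖) ⁻¹' Ioi (1 / 2) with hUgood
  have hUopen : IsOpen Ugood := by
    have ho : IsOpen {z : EuclideanSpace ℝ (Fin (m + 1)) | gt z ≠ 0} := isOpen_ne_fun hgtc continuous_const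
    refine (hHcont.isOpen_inter_preimage ho isOpen_Ioi).inter ?_
    exact isOpen_lt continuous_const (continuous_norm.comp hgtc)
  have hK₀U : ∀ z ∈ K, t z = 0 → z ∈ Ugood := by
    intro z hz htz
    have hGz : G z = 0 := (mul_eq_zero.1 htz).resolve_left (hupos z).ne'
    obtain ⟨-, hn1, -⟩ := hzero z hz hGz
    refine ⟨⟨hK₀sub ⟨hz, hGz⟩, ?_⟩, ?_⟩
    · show Hfun z ∈ Ioi H₀
      have := hκle z ⟨hz, hGz⟩
      rw [mem_Ioi, hH₀]; linarith
    · show ‖gt z‖ ∈ Ioi (1 / 2 : ℝ)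
      rw [mem_Ioi, hn1]; norm_num
  obtain ⟨wd, hω, hωU⟩ := exists_pos_forall_abs_le_subset hK htc.continuous.continuousOn hUopen hK₀U
  -- ### conclusions
  refine ⟨u, C_t, M₁, M₂, H₀, wd, huc, hupos, hC_tpos, by rw [hM₁]; positivity, by rw [hM₂]; positivity,
    by rw [hH₀]; positivity, hω, fun z hz => by rw [huK z hz, hgrad_eq], fun z _ => hdt z,
    fun z hz => ?_, fun z hz => ?_, fun z hz => ?_, fun z hz => ?_, fun z hz hzω => ?_⟩
  · -- `|‖∇t‖² - 1| ≤ C_t |t|`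
    exact hdefect z hz
  · exact (hM₁' z hz).trans (by rw [hM₁]; linarith [le_max_left M₁' MG])
  · exact (hM₂' z hz).trans (by rw [hM₂]; linarith)
  · exact (hGt z hz).trans (mul_le_mul_of_nonneg_right (by rw [hM₁]; linarith [le_max_right M₁' MG]) (abs_nonneg _))
  · obtain ⟨⟨-, hH⟩, hn⟩ := hωU z hz hzω
    exact ⟨le_of_lt hn, le_of_lt hH⟩

end Height

end Literature.Geometry.Riemannian

end
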